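import Literature.MathematicalPhysics.KineticTheory.CollisionTubePullbackDefs
import HarnessLib

/-!
# The collision-cylinder pull-back along hard-sphere orbits, II: geometry of the tube

The algebra of Boltzmann's collision cylinder (CIP 1994 §2.2) for one pair: under the pair free flight
`q + s w` the first contact time `t_h = (−b − √(b² − ac))/a` (`a = ‖w‖²`, `b = ⟪q, w⟫`,
`c = ‖q‖² − ε²`) is positive, the flight stays off the contact sphere before it and touches it at `t_h`
(`tube_forward`); flying back for a time `u` from an incoming contact configuration puts the pair in the
tube with `t_h = u` and predicted contact vector the true one (`tube_backward`).  Static consequences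
for the tube terms of `CollisionTubePullbackDefs`: sup bound (`abs_tubeTerm_le`), and a nonzero tube
term of a mark supported in relative speed `< 2L` forces the near-contact shell
`ε < ‖q‖ ≤ ε(1 + 2Lκ)` (`shell_of_tubeTerm_ne_zero`).

## References

* C. Cercignani, R. Illner, M. Pulvirenti, *The Mathematical Theory of Dilute Gases* (1994), §2.2
  (Boltzmann's collision cylinder: the molecules about to hit a given one within time `dt` fill the
  cylinder of height `|V · n| dt` over the protection sphere; pre-collisional hemisphere `V · n < 0`).
  [CIPDiluteGases1994]
* I. Gallagher, L. Saint-Raymond, B. Texier, *From Newton to Boltzmann* (2013), Part II Ch. 4, §4.1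
  (the hard-sphere flow: free flow between collisions, elastic reflection at `|xᵢ − xⱼ| = ε`,
  pre-collisional iff `νⁱʲ · (vᵢ − vⱼ) < 0`; Prop. 4.1.1, Def. 4.1.2). [GallagherSaintRaymondTexier2013]
-/

noncomputable section

open scoped BigOperators Classical InnerProductSpace ENNReal Topology
open Set MeasureTheory Filter Function
open Literature.Analysis.FluidPDE

namespace Literature.MathematicalPhysics.KineticTheory

/-! ## Geometry of the collision tube: the pair free flight -/

section TubeGeometry

variable {V : Type*} [NormedAddCommGroup V] [InnerProductSpace ℝ V]

/-- Expansion of `‖q + s • w‖²`. [folklore] -/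
theorem norm_add_smul_sq (q w : V) (s : ℝ) :
    ‖q + s • w‖ ^ 2 = ‖q‖ ^ 2 + 2 * ⟪q, w⟫_ℝ * s + ‖w‖ ^ 2 * s ^ 2 := by
  rw [norm_add_sq_real, inner_smul_right, norm_smul, mul_pow, Real.norm_eq_abs, sq_abs]
  ring

/-- **Forward tube lemma.**  For a pair at separation `q`, relative velocity `w`, apart
(`ε < ‖q‖`), approaching (`⟪q, w⟫ < 0`) and reaching contact (`‖w‖²(‖q‖² − ε²) ≤ ⟪q, w⟫²`), the
predicted hitting time `t_h = (−b − √(b² − ac))/a` is positive, the free flight `q + s w` stays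
strictly outside the contact sphere for `0 ≤ s < t_h` and is at contact at `s = t_h`. [folklore] -/
theorem tube_forward {q w : V} {ε : ℝ} (hε : 0 < ε) (hq : ε < ‖q‖) (hb : ⟪q, w⟫_ℝ < 0)
    (hdisc : ‖w‖ ^ 2 * (‖q‖ ^ 2 - ε ^ 2) ≤ ⟪q, w⟫_ℝ ^ 2) :
    0 < (-⟪q, w⟫_ℝ - Real.sqrt (⟪q, w⟫_ℝ ^ 2 - ‖w‖ ^ 2 * (‖q‖ ^ 2 - ε ^ 2))) / ‖w‖ ^ 2 ∧
    ‖q + ((-⟪q, w⟫_ℝ - Real.sqrt (⟪q, w⟫_ℝ ^ 2 - ‖w‖ ^ 2 * (‖q‖ ^ 2 - ε ^ 2))) / ‖w‖ ^ 2) • w‖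
        = ε ∧
    ∀ s : ℝ, 0 ≤ s → s < (-⟪q, w⟫_ℝ - Real.sqrt (⟪q, w⟫_ℝ ^ 2 - ‖w‖ ^ 2 * (‖q‖ ^ 2 - ε ^ 2))) / ‖w‖ ^ 2 →
      ε < ‖q + s • w‖ := by
  have hw0 : w ≠ 0 := by
    rintro rfl
    rw [inner_zero_right] at hb
    exact lt_irrefl _ hb
  set a := ‖w‖ ^ 2 with ha
  set b := ⟪q, w⟫_ℝ with hb'
  set c := ‖q‖ ^ 2 - ε ^ 2 with hc
  have ha0 : 0 < a := by rw [ha]; positivity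
  have hq0 : 0 ≤ ‖q‖ := norm_nonneg q
  have hc0 : 0 < c := by rw [hc]; nlinarith
  have hD0 : 0 ≤ b ^ 2 - a * c := by linarith
  set rt := Real.sqrt (b ^ 2 - a * c) with hrt
  have hrt0 : 0 ≤ rt := Real.sqrt_nonneg _
  have hrt2 : rt ^ 2 = b ^ 2 - a * c := Real.sq_sqrt hD0
  have hrtb : rt < -b := by
    have h1 : rt ^ 2 < (-b) ^ 2 := by rw [hrt2]; nlinarith
    exact lt_of_pow_lt_pow_left₀ 2 (by linarith) h1
  set th := (-b - rt) / a with hth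
  have hth0 : 0 < th := div_pos (by linarith) ha0
  -- the quadratic `f(s) = a s² + 2 b s + c = a (s - th)(s - th')`
  have hfactor : ∀ s : ℝ, a * s ^ 2 + 2 * b * s + c = a * (s - th) * (s - (-b + rt) / a) := by
    intro s
    rw [hth]
    field_simp
    nlinarith [hrt2]
  have hnorm : ∀ s : ℝ, ‖q + s • w‖ ^ 2 = ε ^ 2 + (a * s ^ 2 + 2 * b * s + c) := by
    intro s
    rw [norm_add_smul_sq, ha, hb', hc]
    ring
  refine ⟨hth0, ?_, ?_⟩
  · have h1 : ‖q + th • w‖ ^ 2 = ε ^ 2 := by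
      rw [hnorm, hfactor]
      ring
    exact (pow_left_inj₀ (norm_nonneg _) hε.le two_ne_zero).1 h1
  · intro s hs0 hsth
    have hth' : th ≤ (-b + rt) / a := by
      rw [hth]
      exact div_le_div_of_nonneg_right (by linarith) ha0.le
    have hpos : 0 < a * (s - th) * (s - (-b + rt) / a) := by
      have h1 : s - th < 0 := by linarith
      have h2 : s - (-b + rt) / a < 0 := by linarith
      have : 0 < (s - th) * (s - (-b + rt) / a) := mul_pos_of_neg_of_neg h1 h2
      calc 0 < a * ((s - th) * (s - (-b + rt) / a)) := mul_pos ha0 this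
        _ = a * (s - th) * (s - (-b + rt) / a) := by ring
    have h1 : ε ^ 2 < ‖q + s • w‖ ^ 2 := by
      rw [hnorm, hfactor]
      linarith
    exact lt_of_pow_lt_pow_left₀ 2 (norm_nonneg _) h1

end TubeGeometry

section TubeGeometry2

variable {V : Type*} [NormedAddCommGroup V] [InnerProductSpace ℝ V]

/-- **Backward tube lemma.**  Flying back for a time `u > 0` from an incoming contact
configuration (`‖q₀‖ = ε`, `⟪q₀, w⟫ < 0`) along the pair free flight puts the pair in the tube
with predicted hitting time exactly `u` and predicted contact vector `q₀`: with `q = q₀ − u w`,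
`ε < ‖q‖`, `⟪q, w⟫ < 0`, the discriminant condition holds, `t_h = u` and `q + u w = q₀`.
[folklore] -/
theorem tube_backward {q₀ w : V} {ε u : ℝ} (hq₀ : ‖q₀‖ = ε) (hb₀ : ⟪q₀, w⟫_ℝ < 0)
    (hu : 0 < u) :
    ε < ‖q₀ - u • w‖ ∧ ⟪q₀ - u • w, w⟫_ℝ < 0 ∧
    ‖w‖ ^ 2 * (‖q₀ - u • w‖ ^ 2 - ε ^ 2) ≤ ⟪q₀ - u • w, w⟫_ℝ ^ 2 ∧
    (-⟪q₀ - u • w, w⟫_ℝ -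
        Real.sqrt (⟪q₀ - u • w, w⟫_ℝ ^ 2 - ‖w‖ ^ 2 * (‖q₀ - u • w‖ ^ 2 - ε ^ 2))) / ‖w‖ ^ 2 = u ∧
    q₀ - u • w + u • w = q₀ := by
  have hw0 : w ≠ 0 := by
    rintro rfl
    rw [inner_zero_right] at hb₀
    exact lt_irrefl _ hb₀
  set a := ‖w‖ ^ 2 with ha
  set β := ⟪q₀, w⟫_ℝ with hβ
  have ha0 : 0 < a := by rw [ha]; positivity
  have hinner : ⟪q₀ - u • w, w⟫_ℝ = β - u * a := by
    rw [inner_sub_left, inner_smul_left, real_inner_self_eq_norm_sq, ha, hβ]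
    simp
  have hnorm : ‖q₀ - u • w‖ ^ 2 = ε ^ 2 - 2 * β * u + a * u ^ 2 := by
    rw [sub_eq_add_neg, ← neg_smul, norm_add_smul_sq, hq₀, ha, hβ]
    ring
  have hdisc : ⟪q₀ - u • w, w⟫_ℝ ^ 2 - ‖w‖ ^ 2 * (‖q₀ - u • w‖ ^ 2 - ε ^ 2) = β ^ 2 := by
    rw [hinner, hnorm, ← ha]
    ring
  have hsqrt : Real.sqrt (β ^ 2) = -β := by
    rw [Real.sqrt_sq_eq_abs, abs_of_neg hb₀]
  refine ⟨?_, ?_, ?_, ?_, sub_add_cancel _ _⟩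
  · have h1 : ε ^ 2 < ‖q₀ - u • w‖ ^ 2 := by
      rw [hnorm]
      nlinarith [mul_pos hu ha0]
    exact lt_of_pow_lt_pow_left₀ 2 (norm_nonneg _) h1
  · rw [hinner]
    nlinarith [mul_pos hu ha0]
  · have : ‖w‖ ^ 2 * (‖q₀ - u • w‖ ^ 2 - ε ^ 2) = ⟪q₀ - u • w, w⟫_ℝ ^ 2 - β ^ 2 := by
      linarith [hdisc]
    rw [this]
    nlinarith [sq_nonneg β]
  · rw [hdisc, hsqrt, hinner]
    field_simp
    ring

end TubeGeometry2

/-! ## Two elementary flight estimates -/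

section FlightEstimates

/-- Along the flight `q + s w` towards a contact at `s = t_h` (`‖q + t_h w‖ = ε`), the separation at
an intermediate time is within `(t_h − s)‖w‖` of `ε`. [folklore] -/
theorem norm_add_smul_le_of_contact {q w : V3} {ε th s : ℝ} (hc : ‖q + th • w‖ = ε) (hs : s ≤ th) :
    ‖q + s • w‖ ≤ ε + (th - s) * ‖w‖ := by
  have : q + s • w = (q + th • w) - (th - s) • w := by
    rw [sub_smul]; abel
  rw [this]
  calc ‖q + th • w - (th - s) • w‖ ≤ ‖q + th • w‖ + ‖(th - s) • w‖ := norm_sub_le _ _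
    _ = ε + (th - s) * ‖w‖ := by rw [hc, norm_smul, Real.norm_of_nonneg (sub_nonneg.2 hs)]

/-- Elementary: `ε + t_h ‖w‖ ≤ ε (1 + 2 L κ)` for `t_h ≤ κ ε`, `‖w‖ ≤ 2L`. [folklore] -/
theorem eps_add_mul_le {ε th nw L κ : ℝ} (hε : 0 ≤ ε) (hκ : 0 ≤ κ)
    (hth : th ≤ κ * ε) (hnw0 : 0 ≤ nw) (hnw : nw ≤ 2 * L) :
    ε + th * nw ≤ ε * (1 + 2 * L * κ) := by
  have : th * nw ≤ κ * ε * (2 * L) := mul_le_mul hth hnw hnw0 (by positivity)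
  nlinarith

end FlightEstimates

/-! ## Static facts about the tube terms -/

section TubeTermStatic

variable {σ : ℝ} {N : ℕ} {χ : ℝ × UnitAddTorus (Fin 3) → ℝ} {g : ℝ → ℝ} {Ψ : V3 × V3 × V3 → ℝ}
  {r κ : ℝ}

/-- Off the tube the tube term vanishes; on it, it is the weight times the mark. [folklore] -/
theorem tubeTerm_eq_ite (t : ℝ) (ζ : Config (N + 1) (Fin 3) T3) (i j : Fin (N + 1)) :
    tubeTerm σ N χ g Ψ r κ t ζ i j =
      if i ≠ j ∧ hsDiameter σ N < ‖sepAt ζ i j‖ ∧ ⟪sepAt ζ i j, relVel ζ i j⟫_ℝ < 0 ∧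
          ‖relVel ζ i j‖ ^ 2 * (‖sepAt ζ i j‖ ^ 2 - hsDiameter σ N ^ 2) ≤ ⟪sepAt ζ i j, relVel ζ i j⟫_ℝ ^ 2 ∧
          hitTime (hsDiameter σ N) (sepAt ζ i j) (relVel ζ i j) ≤ κ * hsDiameter σ N then
        weightAt σ N χ g r t ζ i *
          Ψ ((hsDiameter σ N)⁻¹ • (sepAt ζ i j +
              hitTime (hsDiameter σ N) (sepAt ζ i j) (relVel ζ i j) • relVel ζ i j), (ζ i).2, (ζ j).2)
      else 0 :=
  rfl

/-- The cone kernel is nonnegative for `r > 0`. [folklore] -/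
theorem coneKernel_nonneg {r : ℝ} (hr : 0 < r) (x y : UnitAddTorus (Fin 3)) : 0 ≤ coneKernel r x y := by
  unfold coneKernel
  exact mul_nonneg (by positivity) (le_max_right _ _)

/-- The mollified empirical density is nonnegative for `r > 0`. [folklore] -/
theorem mollDensity_nonneg {r : ℝ} (hr : 0 < r) (ζ : Config (N + 1) (Fin 3) T3)
    (x : UnitAddTorus (Fin 3)) : 0 ≤ mollDensity r ζ x := by
  unfold mollDensity
  rw [integral_empiricalMeasure]
  exact mul_nonneg (inv_nonneg.2 (by positivity)) (Finset.sum_nonneg fun k _ => coneKernel_nonneg hr _ _)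

/-- Bound on the weight `χ g` on `[0, τ]`: `|χ(t, xᵢ) g(σ³ρ_r(xᵢ))| ≤ C_χ C_g` when `|χ| ≤ C_χ` on
`[0, τ] × 𝕋³`, `|g| ≤ C_g` on `[0, ∞)`, `σ ≥ 0`, `r > 0`. [folklore] -/
theorem abs_weightAt_le {τ Cχ Cg : ℝ} (hχb : ∀ t ∈ Icc (0 : ℝ) τ, ∀ x, |χ (t, x)| ≤ Cχ)
    (hgb : ∀ a, 0 ≤ a → |g a| ≤ Cg) (hσ : 0 ≤ σ) (hr : 0 < r) {t : ℝ} (ht : t ∈ Icc (0 : ℝ) τ)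
    (ζ : Config (N + 1) (Fin 3) T3) (i : Fin (N + 1)) :
    |weightAt σ N χ g r t ζ i| ≤ Cχ * Cg := by
  unfold weightAt
  rw [abs_mul]
  have h0 : 0 ≤ σ ^ 3 * mollDensity r ζ (ζ i).1 := mul_nonneg (pow_nonneg hσ 3) (mollDensity_nonneg hr ζ _)
  exact mul_le_mul (hχb t ht _) (hgb _ h0) (abs_nonneg _) ((abs_nonneg _).trans (hχb t ht (ζ i).1))

/-- **Sup bound for one tube term** on `[0, τ]`: `|tubeTerm| ≤ C_χ C_g C_Ψ`. [folklore] -/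
theorem abs_tubeTerm_le {τ Cχ Cg CΨ : ℝ} (hχb : ∀ t ∈ Icc (0 : ℝ) τ, ∀ x, |χ (t, x)| ≤ Cχ)
    (hgb : ∀ a, 0 ≤ a → |g a| ≤ Cg) (hΨb : ∀ p, |Ψ p| ≤ CΨ) (hσ : 0 ≤ σ) (hr : 0 < r) {t : ℝ}
    (ht : t ∈ Icc (0 : ℝ) τ) (ζ : Config (N + 1) (Fin 3) T3) (i j : Fin (N + 1)) :
    |tubeTerm σ N χ g Ψ r κ t ζ i j| ≤ Cχ * Cg * CΨ := by
  have hw := abs_weightAt_le hχb hgb hσ hr ht ζ i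
  have hC : 0 ≤ Cχ * Cg := (abs_nonneg _).trans hw
  rw [tubeTerm_eq_ite]
  split_ifs
  · rw [abs_mul]
    exact mul_le_mul hw (hΨb _) (abs_nonneg _) hC
  · rw [abs_zero]
    exact mul_nonneg hC ((abs_nonneg _).trans (hΨb 0))

/-- **A nonzero tube term sits in the near-contact shell.**  If the mark `Ψ(n, v, w)` vanishes
for `2L ≤ ‖w − v‖`, `ε > 0` and `κ ≥ 0`, then `tubeTerm … ζ i j ≠ 0` forces
`ε < ‖q‖ ≤ ε (1 + 2 L κ)` for the minimal-image separation `q` of `(i, j)`: the pair reaches contact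
after a flight of duration `t_h ≤ κ ε` at relative speed `< 2L`. [folklore] -/
theorem shell_of_tubeTerm_ne_zero {L : ℝ} (hΨ0 : ∀ n v w : V3, 2 * L ≤ ‖w - v‖ → Ψ (n, v, w) = 0)
    (hε : 0 < hsDiameter σ N) (hκ : 0 ≤ κ) {t : ℝ} {ζ : Config (N + 1) (Fin 3) T3} {i j : Fin (N + 1)}
    (hne : tubeTerm σ N χ g Ψ r κ t ζ i j ≠ 0) :
    hsDiameter σ N < ‖sepAt ζ i j‖ ∧ ‖sepAt ζ i j‖ ≤ hsDiameter σ N * (1 + 2 * L * κ) := by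
  rw [tubeTerm_eq_ite] at hne
  split_ifs at hne with hcond
  · obtain ⟨-, hq, hb, hdisc, hth⟩ := hcond
    refine ⟨hq, ?_⟩
    have hΨne : Ψ ((hsDiameter σ N)⁻¹ • (sepAt ζ i j +
        hitTime (hsDiameter σ N) (sepAt ζ i j) (relVel ζ i j) • relVel ζ i j), (ζ i).2, (ζ j).2) ≠ 0 :=
      fun h0 => hne (by rw [h0, mul_zero])
    have hw : ‖relVel ζ i j‖ < 2 * L := by
      by_contra hle
      refine hΨne (hΨ0 _ _ _ ?_)
      rw [← norm_neg, neg_sub]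
      exact not_lt.1 hle
    obtain ⟨hth0, hcontact, -⟩ := tube_forward hε hq hb hdisc
    set th := hitTime (hsDiameter σ N) (sepAt ζ i j) (relVel ζ i j) with hthdef
    have hth' : (-⟪sepAt ζ i j, relVel ζ i j⟫_ℝ - Real.sqrt (⟪sepAt ζ i j, relVel ζ i j⟫_ℝ ^ 2 -
        ‖relVel ζ i j‖ ^ 2 * (‖sepAt ζ i j‖ ^ 2 - hsDiameter σ N ^ 2))) / ‖relVel ζ i j‖ ^ 2 = th := rfl
    rw [hth'] at hth0 hcontact
    calc ‖sepAt ζ i j‖ = ‖(sepAt ζ i j + th • relVel ζ i j) - th • relVel ζ i j‖ := by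
          rw [add_sub_cancel_right]
      _ ≤ ‖sepAt ζ i j + th • relVel ζ i j‖ + ‖th • relVel ζ i j‖ := norm_sub_le _ _
      _ = hsDiameter σ N + th * ‖relVel ζ i j‖ := by
          rw [hcontact, norm_smul, Real.norm_of_nonneg hth0.le]
      _ ≤ hsDiameter σ N + κ * hsDiameter σ N * (2 * L) :=
          add_le_add le_rfl (mul_le_mul hth hw.le (norm_nonneg _) (by positivity))
      _ = hsDiameter σ N * (1 + 2 * L * κ) := by ring
  · exact absurd rfl hne

end TubeTermStatic

end Literature.MathematicalPhysics.KineticTheory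

end
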